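import Literature.NumberTheory.EllipticCurves.CastellaGrossiLeeSkinner2022.KatzPAdicLFunctionFrame
import HarnessLib

/-!
# Fan–Wan, arXiv:2304.09806v2, Proposition 3.6 `\ref{Int}` (FanWan_v2.tex l.1515–1528) with
# Definition 5.23 `\ref{pLf}` (l.1957–1960): the INTERPOLATION PROPERTY of the anticyclotomic
# `p`-adic `L`-function `𝓛°_ψ = 𝒫_φ` (Eisenstein case) at a NON-SPLIT prime `p` — every `p`,
# `p = 2` included — as a CHARACTERISING PREDICATE over the tree's `p`-adic-`L`-function vocabulary

Cell `bsd-cn100` (HOME `run/shared/lean/pub/bsd-cn100/`), seat `bsd-cn100-transfer-2` g0, deliverable D2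
of `bsd-cn100-plan/D0074-bsd-cn100-seats.md` §3: "the INTERPOLATION PROPERTY as a typed, field-free
statement over the tree's p-adic-L-function vocabulary (template `BDPAnticyclotomicPAdicLFunction.lean`)",
to be FILED BY THE TYPER SEAT `bsd-cn100-ty` in its Fan–Wan section module (D-0064: one file per source
section; the typer owns `Literature/NumberTheory/EllipticCurves/FanWan2023/`). DEFINITIONS ONLY, in the
exact pattern of `IsBDPLFunction` / `IsKatzLFunction` (`CastellaGrossiLeeSkinner2022/KatzPAdicLFunctionFrame`):
a receptacle, an evaluation predicate, the characterising predicate with every period / constant a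
BINDER, and NO closed existence claim (see "What is NOT typed" — the honest reason). `lean check` rc 0.

STATUS OF THE SOURCE. Fan–Wan v2 is an UNREFEREED preprint ([claim: FanWan2023, status: under-review]).
Prop \ref{Int} AS PRINTED carries the cell's read1-fw-1 GAP ("adapting [AI, Prop 5.6 & 6.4]" at a
ramified prime, `p = 2`); AS COMPLETED by the cell's repair bundle item (a) — MEMO-transfer-1 (sha256
05364140…: §1 `Int_min(p,K)`, T0–T1), MEMO-transfer-2 (16cafba9…: Lemma CS_w, Prop T2), MEMO-transfer-5
§(a) (T3–T5) — it is CLOSED at two-read referee depth for `(p,K) = (2, ℚ(i))` and `(3, ℚ(√−3))`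
(VERDICT Part VI §1–2, Part IX §3 row (a)), with the `p = 2` floors `ℓ − n ≥ ℓ₀(2,ℚ(i)) = 3`, sheaf level
`i = n ≥ 2`, hypothesis (H_ℓ). Nothing here asserts it; the predicate is what a proof would establish.

FILING. Filed under `Literature/NumberTheory/EllipticCurves/FanWan2023/` (source section §3.3 + §5.3 of
Fan–Wan v2 — the `p`-adic `L`-function; the main-theorem section is `NonsplitPConverseClaims.lean`) by the
typer seat `bsd-cn100-ty` g2, verbatim from `HOME/bsd-cn100-transfer-2/PropInt.lean` (sha16 c4ca1098c765c8d7,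
author seat `bsd-cn100-transfer-2` g0), one writer per source directory (D-0064).

## The printed statement (verbatim, l.1515–1524, Eisenstein case, `p` non-split)

"PROPOSITION [Int]. The function `𝒫_φ` is locally analytic on `𝒲(k)` and for `μ ∈ Σ⁺(k)`,
`𝒫_φ(μ) = Ω_p^{2ν+k} P_μ^{alg}(φ)`. […] In the Eisenstein case,
`𝒫_φ(μ)/Ω_p^{2ν+k} = p^{(ℓ−2n+s−1)ν} L(0,μ) / (2 L(1,χ_𝒦) L(1,ω_{1−k}^{−1}) Ω_∞^{2ν+k}) · C(k,ν) ·
∏_{v<∞} λ_{μ_v}(φ_v(−g_{ℓ,n}))` (`p` non-split). Here for `v ≠ p`, we understand `g_{ℓ,n} = 1`."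
With (l.1513) "In the Eisenstein case, `C(k,ν) := λ_{μ_v}(Δ^ν φ_v)` depends only on `(k,ν)`", and the
remarks l.1529–1533: for `v ∤ p∞` NON-SPLIT in `𝒦` the local factor `μ_v ↦ λ_{μ_v}(φ_v)` "is constant by
construction"; for `v ∤ p∞` SPLIT it "is regular … essentially the local epsilon-factor (thus a unit in
the Iwasawa algebra) for specific `φ_v`". DEFINITION [pLf] (l.1957–1960): "We write `𝓛°_ψ` for the
`p`-adic `L`-function `𝒫_φ` in the Eisenstein case which interpolates the algebraic part of the
`L`-values `L(𝒦, 𝛙_φ)` for `φ` in `𝔛₁` […]. Note that the origin point `φ₀` IS an interpolation point —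
this corresponds to `k = 1`, `j = 0` in [AI, 2.3.1]. […] Note that these `p`-adic `L`-functions live in
some ring `Λ^{−,′}_L ≅ 𝒪_L⟦p^{−m}X⟧ ⊗ L` for `m ≫ 0`." ARITHMETIC POINTS (§5.3, l.1757–1765):
`𝛙 = ψ Ψ⁻_𝒦` with `Ψ⁻_𝒦 : G_𝒦 → Γ⁻_𝒦 ↪ 𝒪_L⟦Γ⁻_𝒦⟧` the universal character of the anticyclotomic
`ℤ_p`-extension; "a `ℂ_p`-point `φ` of `Spec 𝒪_L⟦p^{−m}X⟧` sends `X` to `φ(X)` with `|φ(X)|_p < p^{−m}`";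
`φ` is ARITHMETIC if the specialisation of `Ψ⁻_𝒦` at `φ` is the `p`-avatar of a Hecke character of
`𝒦` of Archimedean type `(−κ, κ)` (`κ` even); `𝔛₁ = {φ arithmetic : κ_φ ≥ 0, 2(p²−1) ∣ κ_φ}`
(Def. 5.9, l.1764; Lemma 5.10 `\ref{punchged}`: then `𝛙_φ` and `ψ` have the same `p`-component, `m > 1`).

## Transcription (each item a parameter or the tree's established device; compare `IsKatzLFunction`)

* RECEPTACLE `Λ^{−,′}_L`: power series in `X = γ − 1` with coefficients in `ℂ_p` (we do not fix the
  coefficient field `L`), `DiscSeries p := PowerSeries ℂ_[p]`, evaluated by `HasSum` at points `x` of the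
  disc `‖x‖ < p^{−m}` (`DiscSeries.HasValueAt`, `DiscSeries.ConvergesOnBall`). This is the ONE structural
  difference from the BDP/Katz frames (`UnrSeries p = R₀⟦T⟧`, Iwasawa functions on the unit disc):
  at a non-split prime the function is only LOCALLY analytic ("supersingular" growth), l.1960.
* `𝛙_φ ↦ ψ * χ` with `χ` the Hecke character whose avatar is the specialisation of `Ψ⁻_𝒦` at `φ`:
  `χ` UNRAMIFIED OUTSIDE `p` (l.1789: "the specialization of `Ψ⁻_𝒦` at `φ` is unramified at all primes
  `v ∤ p∞`"), of infinity type `(κ, −κ)` in the tree's convention (`HasInfinityType (κ) (−κ)`, as in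
  `IsBDPLFunction`; FW's "(−κ, κ)" with `χ_∞(z) = z^{a} z̄^{b}`), `κ ≥ 0`, `2(p²−1) ∣ κ` (`𝔛₁`); its avatar
  `r` factors through the anticyclotomic `ℤ_p`-extension `κ⁻` (`FactorsThroughZp`) and the point is
  `x = r(γ) − 1` (`avatarValueAt r γ - 1`) with `‖x‖ < p^{−m}`.
* "the algebraic part of `L(𝒦, 𝛙_φ)`" ↦ `C κ χ · L(ψχ, s₀) / Ω_∞^{2κ+1}`, the `p`-adic value being this
  (through `ι⁻¹ : ℂ → ℚ̄_p ⊂ ℂ_p`) times `Ω_p^{2κ+1}` (FW: `Ω_p^{2ν+k}` with Eisenstein weight `k = 1`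
  for `ψ` of type `(−1,0)` and `ν = κ_φ` — transcription choice, recorded); `L(ψχ, s₀)` is read through
  an entire-continuation BINDER of the tree's `heckeLFunction (ψ * χ)` (unique value; the named fact
  `heckeLFunction_hasEntireContinuation_of_not_isNormTwist` supplies it), `s₀` a PARAMETER (meant: the
  central critical point, `s₀ = 1` in the arithmetic normalisation `L(ψ_E, s) = L(E, s)`; FW's display
  uses the unitary `L(0, μ)`).
* THE CONSTANT SYSTEM `C : ℕ → HeckeCharacter K → ℂ` (meant: FW's
  `p^{(ℓ−2n+s−1)ν} C(k,ν) ∏_{v<∞} λ_{μ_v}(φ_v(−g_{ℓ,n})) / (2 L(1,χ_𝒦) L(1,ω^{−1}_{1−k}))`, depending on the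
  character ONLY through `ν = κ` and its local components at the finitely many places of the tame level —
  MEMO-transfer-1 §1 (β)(γ); non-zero exactly under the test-vector condition of App. A, read1-fw-2 /
  read2 A.1, certified numerically for the congruent-number data in MEMO-transfer-3, kit j243866) is a
  PARAMETER, like the periods `Ω_∞ ∈ ℂ`, `Ω_p ∈ ℂ_p` and the radius exponent `m`.

## What is NOT typed, and why (honest framing)

No CLOSED existence claim `∃ 𝓛°_ψ` is stated: with the constant system `C` quantified existentially
(the tree has no vocabulary for the local toric period integrals `λ_{μ_v}` of App. A, nor for nearly
overconvergent quaternionic forms), "∃ C ∃ Ω ∃ L, IsNonsplitRubinLFunction …" would be satisfiable by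
junk (choose `L` first, then `C`), exactly the `∃`-junk the cell's plan forbids (g5/g6 dead ends). The
claim is therefore typed RELATIVE TO a given constant system (`propInt_pLf_CLAIMED C`), to be closed over
FW's actual `C` when App. A's local integrals are typed (typer / MEMO-transfer-3 data). Consumers
downstream (Thm 5.18 [RMCC] `char(X⁻_ψ) = (𝓛•_ψ)`, the length identity (PRCJ) of Thm 6.9) quantify over a
witness `L` of THIS predicate with the SAME binders — never over "any `L`".

## References
* [FanWan2023] Prop. 3.6 `\ref{Int}` (l.1515–1528), Def. 3.4/3.5 (l.1496–1512), Lemma 3.3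
  `\ref{algebracity}` (l.1441), Def. 5.23 `\ref{pLf}` (l.1957–1960), §5.3 (l.1750–1765), l.2093 (`𝓛•_ψ`).
* [AndreattaIovita2024] F. Andreatta, A. Iovita, *Katz type p-adic L-functions for primes p non-split in
  the CM field*, CMH 99 (2024) = arXiv:1905.00792, Props 5.6/6.4, 5.9/6.6 (the refereed inert/ramified
  `p ≥ 3`… template FW adapt).
* Cell texts: MEMO-transfer-1 §1 (`Int_min`), MEMO-transfer-2 (CS_w, T2), VERDICT VI §1–2, IX §3.
* Tree templates: `IsBDPLFunction` [Castella2018, Thm. 3.1], `IsKatzLFunction` [CGLS2022, Thm. 2.1.2].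
-/

noncomputable section

open scoped Topology
open NumberField IsDedekindDomain Field
open Literature.NumberTheory.GaloisRepresentations Literature.NumberTheory.EllipticCurves

namespace Literature.NumberTheory.EllipticCurves.FanWan2023

universe u

/-! ### §1. The receptacle `Λ^{−,′}_L`: power series on a small `p`-adic disc -/

section Receptacle

variable (p : ℕ) [Fact p.Prime]

/-- **FW's coefficient ring `Λ^{−,′}_L ≅ 𝒪_L⟦p^{−m}X⟧ ⊗ L`, read as formal power series in
`X = γ − 1` with `ℂ_p`-coefficients** (the coefficient field `L/ℚ_p` "large enough", l.1477, is not
fixed; membership of the coefficients in a finite extension is not part of the interpolation property).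
Evaluation at `ℂ_p`-points of the disc `|X| < p^{−m}` is `DiscSeries.HasValueAt`.
[cite: FanWan2023, Def. 5.23 (l.1960) and §5.3 (l.1755–1757)] -/
abbrev DiscSeries : Type := PowerSeries ℂ_[p]

variable {p}

/-- **The value of `L ∈ Λ^{−,′}_L` at the `ℂ_p`-point `X = x`**: `∑_k [X^k]L · x^k = v` (a `HasSum` in
`ℂ_p`; FW: "a `ℂ_p`-point `φ` … sends `X` to `φ(X)` with `|φ(X)|_p < p^{−m}`", l.1757). Pattern of the
tree's `UnrSeries.HasValueAt`. [cite: FanWan2023, §5.3 (l.1757)] -/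
def DiscSeries.HasValueAt (L : DiscSeries p) (x v : ℂ_[p]) : Prop :=
  HasSum (fun k : ℕ ↦ PowerSeries.coeff k L * x ^ k) v

/-- **`L` converges on the open disc of radius `ρ`** ("locally analytic", Prop. \ref{Int}; for
`Λ^{−,′}_L` the radius is `p^{−m}`, l.1757). [cite: FanWan2023, Prop. 3.6 (l.1515) and §5.3 (l.1757)] -/
def DiscSeries.ConvergesOnBall (L : DiscSeries p) (ρ : ℝ) : Prop :=
  ∀ x : ℂ_[p], ‖x‖ < ρ → ∃ v : ℂ_[p], L.HasValueAt x v

/-- The value at a point is unique (a `HasSum` limit in the Hausdorff space `ℂ_p`); private plumbing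
(consumers use `HasSum.unique` directly). [folklore] -/
private theorem DiscSeries.HasValueAt.unique {L : DiscSeries p} {x v v' : ℂ_[p]} (h : L.HasValueAt x v)
    (h' : L.HasValueAt x v') : v = v' :=
  HasSum.unique h h'

/-- **The value at the origin `φ₀` (`X = 0`, the trivial character of `Γ⁻`) is the constant term** —
FW's `φ₀(𝓛)`; by Def. \ref{pLf} the origin IS an interpolation point of `𝓛°_ψ`.
[cite: FanWan2023, Def. 5.23 (l.1958)] -/
theorem DiscSeries.hasValueAt_zero (L : DiscSeries p) :
    L.HasValueAt 0 (PowerSeries.constantCoeff L) := by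
  have h := hasSum_single (f := fun k : ℕ ↦ PowerSeries.coeff k L * (0 : ℂ_[p]) ^ k) 0
    (fun k hk ↦ by rw [zero_pow hk, mul_zero])
  simpa [DiscSeries.HasValueAt] using h

end Receptacle

/-! ### §2. The interpolation property of `𝓛°_ψ` (Prop. \ref{Int}, Eisenstein case, with Def. \ref{pLf}) -/

section Interpolation

variable {K : Type u} [Field K] [NumberField K] {p : ℕ} [Fact p.Prime]

/-- **Fan–Wan v2, Prop. 3.6 `\ref{Int}` + Def. 5.23 `\ref{pLf}` — the interpolation property of the
one-variable anticyclotomic `p`-adic `L`-function `𝓛°_ψ ∈ Λ^{−,′}_L` of a Hecke character `ψ` of the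
imaginary quadratic field `K` at a NON-SPLIT prime `p` (ANY `p`, `p = 2` included), as a characterising
PREDICATE** on `L : DiscSeries p` (nothing asserted, no construction): for every Hecke character `χ` of
`K` unramified outside `p`, of infinity type `HasInfinityType (κ) (−κ)` with `2(p²−1) ∣ κ` (the
arithmetic points `𝔛₁`; `κ = 0`, `χ` trivial, is the origin `φ₀`), every entire continuation `hL` of the
tree's `L(ψχ, s)` (a binder; unique value), and every `p`-adic avatar `r` of `χ` (`IsPAdicAvatarOf ι χ r`)
factoring through the anticyclotomic `ℤ_p`-extension `κ⁻` (`FactorsThroughZp κ⁻ r`) whose point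
`x = r(γ) − 1` lies in the disc `‖x‖ < p^{−m}`, the value of `L` at `x` is
`ι⁻¹(C κ χ · L(ψχ, s₀) / Ω_∞^{2κ+1}) · Ω_p^{2κ+1}`. PARAMETERS (all binders, as in `IsKatzLFunction`):
`ι : ℚ̄_p ≃ ℂ`; `κ⁻`, `γ` (meant: THE anticyclotomic `ℤ_p`-extension and a topological generator); `ψ`
(meant: self-dual of Archimedean type `(−1,0)`, `ψ|_{𝔸_ℚ^×} = |·|^{−1} χ_𝒦`, l.512 — e.g. `ψ_{E_n}` over
`ℚ(i)` at `p = 2`); `s₀` (meant: the central point); `m` (the radius exponent of `Λ^{−,′}`, "m ≫ 0");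
`C` (meant: FW's constant system, module docstring); `Ω_∞ ∈ ℂ`, `Ω_p ∈ ℂ_p` (the CM periods of
l.1478–1481; at a non-split prime `v_p(Ω_p) = −1/(2p^ℓ(p−1))` in the ramified case, so `Ω_p` is NOT a
unit — it is a binder here exactly as in the BDP frame). [claim: FanWan2023, status: under-review]
[cite: FanWan2023, Prop. 3.6 (l.1515–1524), Def. 5.23 (l.1957–1960), Def. 5.9 (l.1764)] -/
def IsNonsplitRubinLFunction (ι : PadicAlgCl p ≃+* ℂ) (κac : ZpExtension K p)
    (γ : absoluteGaloisGroup K) (ψ : HeckeCharacter K) (s₀ : ℂ) (m : ℕ)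
    (C : ℕ → HeckeCharacter K → ℂ) (Ωinf : ℂ) (Ωp : ℂ_[p]) (L : DiscSeries p) : Prop :=
  ∀ (χ : HeckeCharacter K) (k : ℕ), 2 * (p ^ 2 - 1) ∣ k →
    (∀ w : HeightOneSpectrum (𝓞 K), ((p : ℕ) : 𝓞 K) ∉ w.asIdeal → χ.IsUnramifiedAt w) →
    χ.HasInfinityType (fun _ ↦ (k : ℤ)) (fun _ ↦ -(k : ℤ)) →
    ∀ (hL : LFunction.HasEntireContinuation (heckeLFunction (ψ * χ))),
    ∀ r : FramedGaloisRep K (PadicAlgCl p) 1, IsPAdicAvatarOf ι χ r → FactorsThroughZp κac r →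
      ‖avatarValueAt r γ - 1‖ < (p : ℝ) ^ (-(m : ℤ)) →
      L.HasValueAt (avatarValueAt r γ - 1)
        (((ι.symm (C k χ * hL.continuation s₀ / Ωinf ^ (2 * k + 1)) : PadicAlgCl p) : ℂ_[p]) *
          Ωp ^ (2 * k + 1))

/-- **Locality and non-vanishing of the constant system** (MEMO-transfer-1 §1 (β)(γ), FW l.1513 and
l.1529–1533): `C κ χ` depends on `χ` only through `κ` and the local components `χ(ϖ_v)` at the places of
a fixed finite set `S` (the tame level), and is non-zero. Stated as a predicate on `C`; the EXACT
constants (local toric integrals of App. A) are not tree-typed. [claim: FanWan2023, status: under-review]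
[cite: FanWan2023, l.1513 and l.1529–1533] -/
def IsLocalConstantSystem (S : Finset (HeightOneSpectrum (𝓞 K))) (C : ℕ → HeckeCharacter K → ℂ) :
    Prop :=
  (∀ (k : ℕ) (χ χ' : HeckeCharacter K),
      (∀ v ∈ S, χ.valueAtUniformizer v = χ'.valueAtUniformizer v) → C k χ = C k χ') ∧
    ∀ (k : ℕ) (χ : HeckeCharacter K), C k χ ≠ 0

/-- **Prop. \ref{Int} + Def. \ref{pLf} as an existence CLAIM, RELATIVE TO a constant system `C`**
(UNREFEREED; cell repair-bundle item (a) CLOSED two-read at `(2, ℚ(i))`, `(3, ℚ(√−3))`, VERDICT IX §3):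
for `K` imaginary quadratic with `p` NOT split (one prime of `K` above `p`: inert or ramified), `κ⁻` the
anticyclotomic `ℤ_p`-extension with topological generator `γ`, and `ψ` a Hecke character of `K` (meant:
self-dual of type `(−1,0)`), there are a radius exponent `m`, periods `Ω_∞ ≠ 0`, `Ω_p ≠ 0` and
`L ∈ Λ^{−,′}_L` converging on `‖X‖ < p^{−m}` with the interpolation property for the constant system
`C` (a PARAMETER of this `Prop` — see the module docstring for why it is not quantified). Consumers must
instantiate `C` with Fan–Wan's constants; for an arbitrary `C` the statement is not claimed by anyone.
NEVER cite as a theorem. [claim: FanWan2023, status: under-review]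
[cite: FanWan2023, Prop. 3.6 (l.1515–1528) and Def. 5.23 (l.1957–1960)] -/
def propInt_pLf_CLAIMED (s₀ : ℂ) (C : ∀ (K : Type) [Field K] [NumberField K], ℕ → HeckeCharacter K → ℂ) :
    Prop :=
  ∀ {p : ℕ} [Fact p.Prime] (ι : PadicAlgCl p ≃+* ℂ) (K : Type) [Field K] [NumberField K]
    (κac : ZpExtension K p) (γ : absoluteGaloisGroup K) (ψ : HeckeCharacter K),
    IsImaginaryQuadratic K → ((Ideal.span {(p : ℤ)}).primesOver (𝓞 K)).ncard = 1 →
    κac.IsAnticyclotomic → κac.IsTopGenerator γ →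
    ∃ (m : ℕ) (Ωinf : ℂ) (Ωp : ℂ_[p]) (L : DiscSeries p),
      Ωinf ≠ 0 ∧ Ωp ≠ 0 ∧ L.ConvergesOnBall ((p : ℝ) ^ (-(m : ℤ))) ∧
        IsNonsplitRubinLFunction ι κac γ ψ s₀ m (C K) Ωinf Ωp L

/-! #### API -/

variable {ι : PadicAlgCl p ≃+* ℂ} {κac : ZpExtension K p} {γ : absoluteGaloisGroup K}
  {ψ : HeckeCharacter K} {s₀ : ℂ} {m : ℕ} {C : ℕ → HeckeCharacter K → ℂ} {Ωinf : ℂ} {Ωp : ℂ_[p]}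
  {L : DiscSeries p}

/-- Unfolding `IsNonsplitRubinLFunction` at one arithmetic point of `𝔛₁`: the prescribed value at
`X = r(γ) − 1`. [claim: FanWan2023, status: under-review] [cite: FanWan2023, Prop. 3.6 (l.1515)] -/
theorem IsNonsplitRubinLFunction.hasValueAt
    (hL : IsNonsplitRubinLFunction ι κac γ ψ s₀ m C Ωinf Ωp L) {χ : HeckeCharacter K} {k : ℕ}
    (hk : 2 * (p ^ 2 - 1) ∣ k)
    (hunr : ∀ w : HeightOneSpectrum (𝓞 K), ((p : ℕ) : 𝓞 K) ∉ w.asIdeal → χ.IsUnramifiedAt w)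
    (hinf : χ.HasInfinityType (fun _ ↦ (k : ℤ)) (fun _ ↦ -(k : ℤ)))
    (hc : LFunction.HasEntireContinuation (heckeLFunction (ψ * χ)))
    {r : FramedGaloisRep K (PadicAlgCl p) 1} (hr : IsPAdicAvatarOf ι χ r)
    (hκ : FactorsThroughZp κac r) (hx : ‖avatarValueAt r γ - 1‖ < (p : ℝ) ^ (-(m : ℤ))) :
    L.HasValueAt (avatarValueAt r γ - 1)
      (((ι.symm (C k χ * hc.continuation s₀ / Ωinf ^ (2 * k + 1)) : PadicAlgCl p) : ℂ_[p]) *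
        Ωp ^ (2 * k + 1)) :=
  hL χ k hk hunr hinf hc r hr hκ hx

/-- At an arithmetic point of `𝔛₁` the value is pinned: any `v` with `L.HasValueAt (r(γ) − 1) v` equals
the prescribed one (uniqueness of `HasSum` limits). [claim: FanWan2023, status: under-review]
[cite: FanWan2023, Prop. 3.6 (l.1515)] -/
theorem IsNonsplitRubinLFunction.eq_of_hasValueAt
    (hL : IsNonsplitRubinLFunction ι κac γ ψ s₀ m C Ωinf Ωp L) {χ : HeckeCharacter K} {k : ℕ}
    (hk : 2 * (p ^ 2 - 1) ∣ k)
    (hunr : ∀ w : HeightOneSpectrum (𝓞 K), ((p : ℕ) : 𝓞 K) ∉ w.asIdeal → χ.IsUnramifiedAt w)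
    (hinf : χ.HasInfinityType (fun _ ↦ (k : ℤ)) (fun _ ↦ -(k : ℤ)))
    (hc : LFunction.HasEntireContinuation (heckeLFunction (ψ * χ)))
    {r : FramedGaloisRep K (PadicAlgCl p) 1} (hr : IsPAdicAvatarOf ι χ r)
    (hκ : FactorsThroughZp κac r) (hx : ‖avatarValueAt r γ - 1‖ < (p : ℝ) ^ (-(m : ℤ)))
    {v : ℂ_[p]} (hv : L.HasValueAt (avatarValueAt r γ - 1) v) :
    v = ((ι.symm (C k χ * hc.continuation s₀ / Ωinf ^ (2 * k + 1)) : PadicAlgCl p) : ℂ_[p]) *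
        Ωp ^ (2 * k + 1) :=
  hv.unique (hL.hasValueAt hk hunr hinf hc hr hκ hx)

end Interpolation

end Literature.NumberTheory.EllipticCurves.FanWan2023

end
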